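import Mathlib
import Summits.Ventures.PercRepro2.Defs
import Summits.Ventures.PercRepro2.Independence
import Summits.Ventures.PercRepro2.Harris
import Summits.Ventures.PercRepro2.Graph
import Summits.Ventures.PercRepro2.Exploration
import Summits.Ventures.PercRepro2.FourFunctions
import Summits.Ventures.PercRepro2.Induced
import Summits.Ventures.PercRepro2.Frontier
import Summits.Ventures.PercRepro2.CaseOneHB1AvoidStep
import Summits.Ventures.PercRepro2.CaseOneHB1

/-!
# The two-mark avoidance inequality and the theorem `hB1` (blind cell PercRepro2, p1 g36; proofs/P1-HB1.md)

A van den Berg–Kahn-type inequality in which the NON-source marks avoid the explored set. With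
the events `L1, L2, R1, R2` of CaseOneHB1AvoidStep.lean (source `s`, marks `a, o`):

**Theorem** (`TwoMark.twoMark_induced`, `TwoMark.twoMark`):
`P(L1 X) · P(L2 Y) ≤ P(R1 (X ∩ Y)) · P(R2 (X ∪ Y))`.

`X = Y = ∅` is the one-root four-cell inequality; `X = Y = {a₂}` with `s = b`, `a = a₁` is the cell's
missing fact `hB1` of CaseOneHB1.lean — **`CaseOne.HB1_holds`** below: with the source `b`,
cell 1 `= L1 {a₂}`, cell 10 `= L2 {a₂}`, cell 4 `= R1 {a₂}`, cell 9 `= R2 {a₂}`.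

The proof of the theorem is the exploration mechanism of `VdBKahn.lean`: strong induction on `U`;
if `X ∩ Y = ∅` the four functions theorem applies directly (`twoMark_of_inter_eq_empty`);
otherwise explore the edges around `Z = X ∩ Y`: the tower identities of CaseOneHB1AvoidStep.lean
reduce every term to `G[U ∖ Z]` with the frontier `S(ω)` added to the avoided sets, and the four
functions theorem on `Config E` with the induction hypothesis at `(X ∖ Z ∪ S(ω), Y ∖ Z ∪ S(ω'))`
and the lattice properties `S(ω ⊓ ω') ⊆ S(ω) ∩ S(ω')`, `S(ω ⊔ ω') = S(ω) ∪ S(ω')` closes the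
step. Standard axioms. -/

namespace Summit.Ventures.PercRepro2

namespace TwoMark

/-! ## The theorem on induced subgraphs -/

section Main

variable {V : Type*} {E : Type*} [Fintype E] [DecidableEq E] [Fintype V] [DecidableEq V]
  {R : Type*} [CommRing R] [LinearOrder R] [IsStrictOrderedRing R]

omit [Fintype E] [DecidableEq E] [Fintype V] in
/-- If `s`, `a` or `o` lies in `X` then `L1 X` is empty. -/
lemma L1_eq_empty {ends : E → Sym2 V} {U : Finset V} {s a o : V} {X : Finset V}
    (h : s ∈ X ∨ a ∈ X ∨ o ∈ X) : L1 ends U s a o X = ∅ := by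
  rcases h with hs | ha | ho
  · rw [L1, REvent_eq_empty_of_mem ends U (Finset.mem_union_right _ hs), Set.inter_empty,
      Set.empty_inter]
  · rw [L1, QEvent_inter_REvent_eq_empty ends U s (Finset.mem_singleton_self a)
      (Finset.mem_union_right _ ha), Set.empty_inter]
  · rw [L1, REvent_eq_empty_of_mem ends U ho, Set.inter_empty]

omit [Fintype E] [DecidableEq E] [Fintype V] in
/-- If `s`, `a` or `o` lies in `Y` then `L2 Y` is empty. -/
lemma L2_eq_empty {ends : E → Sym2 V} {U : Finset V} {s a o : V} {Y : Finset V}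
    (h : s ∈ Y ∨ a ∈ Y ∨ o ∈ Y) : L2 ends U s a o Y = ∅ := by
  rcases h with hs | ha | ho
  · rw [L2, REvent_eq_empty_of_mem ends U (Finset.mem_union_right _ hs), Set.inter_empty,
      Set.empty_inter]
  · rw [L2, REvent_eq_empty_of_mem ends U ha, Set.inter_empty]
  · rw [L2, QEvent_inter_REvent_eq_empty ends U s (Finset.mem_singleton_self o)
      (Finset.mem_union_right _ ho), Set.empty_inter]

/-- **The two-mark avoidance inequality on induced subgraphs**: for every vertex set `U` and all
`X, Y ⊆ U`, `P(L1 X) · P(L2 Y) ≤ P(R1 (X ∩ Y)) · P(R2 (X ∪ Y))`. -/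
theorem twoMark_induced (p : E → R) (hp : IsProbVec p) (ends : E → Sym2 V) (s a o : V)
    (U : Finset V) :
    ∀ X Y : Finset V, X ⊆ U → Y ⊆ U →
      prob p (L1 ends U s a o X) * prob p (L2 ends U s a o Y) ≤
        prob p (R1 ends U s a o (X ∩ Y)) * prob p (R2 ends U s a o (X ∪ Y)) := by
  induction U using Finset.strongInduction with
  | H U ih =>
  intro X Y hX hY
  by_cases hZ : X ∩ Y = ∅
  · exact twoMark_of_inter_eq_empty p hp ends s a o U X Y hZ
  -- the exploration step: `Z = X ∩ Y ≠ ∅`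
  set Z := X ∩ Y with hZdef
  have hZX : Z ⊆ X := Finset.inter_subset_left
  have hZY : Z ⊆ Y := Finset.inter_subset_right
  have hZU : Z ⊆ U := hZX.trans hX
  have hRnn : 0 ≤ prob p (R1 ends U s a o Z) * prob p (R2 ends U s a o (X ∪ Y)) :=
    mul_nonneg (prob_nonneg hp _) (prob_nonneg hp _)
  by_cases hsZ : s ∈ Z
  · rw [L1_eq_empty (Or.inl (hZX hsZ)), prob_empty, zero_mul]; exact hRnn
  by_cases haZ : a ∈ Z
  · rw [L1_eq_empty (Or.inr (Or.inl (hZX haZ))), prob_empty, zero_mul]; exact hRnn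
  by_cases hoZ : o ∈ Z
  · rw [L1_eq_empty (Or.inr (Or.inr (hZX hoZ))), prob_empty, zero_mul]; exact hRnn
  have hU' : U \ Z ⊂ U := Finset.sdiff_ssubset hZU (Finset.nonempty_iff_ne_empty.2 hZ)
  have hZXY : Z ⊆ X ∪ Y := hZX.trans Finset.subset_union_left
  -- the four terms as sums over configurations (domain Markov identity)
  rw [prob_L1_eq p ends hZU hsZ hoZ hZX, prob_L2_eq p ends hZU hsZ haZ hZY,
    prob_R1_eq p ends hZU hsZ, prob_R2_eq p ends hZU hsZ haZ hoZ hZXY]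
  -- the four functions theorem on the lattice `Config E`
  refine four_functions_theorem_univ
    (fun ω => weight p ω * prob p (L1 ends (U \ Z) s a o ((X \ Z) ∪ frontier ends U Z ω)))
    (fun ω => weight p ω * prob p (L2 ends (U \ Z) s a o ((Y \ Z) ∪ frontier ends U Z ω)))
    (fun ω => weight p ω * prob p (R1 ends (U \ Z) s a o (frontier ends U Z ω)))
    (fun ω => weight p ω * prob p (R2 ends (U \ Z) s a o
      (((X ∪ Y) \ Z) ∪ frontier ends U Z ω)))
    (fun ω => mul_nonneg (weight_nonneg hp ω) (prob_nonneg hp _))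
    (fun ω => mul_nonneg (weight_nonneg hp ω) (prob_nonneg hp _))
    (fun ω => mul_nonneg (weight_nonneg hp ω) (prob_nonneg hp _))
    (fun ω => mul_nonneg (weight_nonneg hp ω) (prob_nonneg hp _)) ?_
  intro ω ω'
  -- induction hypothesis on `U ∖ Z` with the frontiers added to the avoided sets
  have hX'' : (X \ Z) ∪ frontier ends U Z ω ⊆ U \ Z :=
    Finset.union_subset (Finset.sdiff_subset_sdiff hX (le_refl Z)) (frontier_subset ω)
  have hY'' : (Y \ Z) ∪ frontier ends U Z ω' ⊆ U \ Z :=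
    Finset.union_subset (Finset.sdiff_subset_sdiff hY (le_refl Z)) (frontier_subset ω')
  have hIH := ih (U \ Z) hU' ((X \ Z) ∪ frontier ends U Z ω) ((Y \ Z) ∪ frontier ends U Z ω')
    hX'' hY''
  -- `S(ω ⊓ ω') ⊆ S(ω) ∩ S(ω') ⊆ X'' ∩ Y''`
  have h3 : prob p (R1 ends (U \ Z) s a o
      (((X \ Z) ∪ frontier ends U Z ω) ∩ ((Y \ Z) ∪ frontier ends U Z ω'))) ≤
      prob p (R1 ends (U \ Z) s a o (frontier ends U Z (ω ⊓ ω'))) := by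
    refine prob_mono hp (R1_anti ?_)
    exact (frontier_inf_subset ω ω').trans
      (Finset.inter_subset_inter Finset.subset_union_right Finset.subset_union_right)
  -- `X'' ∪ Y'' = (X ∪ Y) ∖ Z ∪ S(ω ⊔ ω')`
  have h4 : prob p (R2 ends (U \ Z) s a o
      (((X \ Z) ∪ frontier ends U Z ω) ∪ ((Y \ Z) ∪ frontier ends U Z ω'))) =
      prob p (R2 ends (U \ Z) s a o (((X ∪ Y) \ Z) ∪ frontier ends U Z (ω ⊔ ω'))) := by
    rw [frontier_sup, Finset.union_sdiff_distrib]
    congr 2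
    ext x
    simp only [Finset.mem_union]
    tauto
  calc weight p ω * prob p (L1 ends (U \ Z) s a o ((X \ Z) ∪ frontier ends U Z ω)) *
        (weight p ω' * prob p (L2 ends (U \ Z) s a o ((Y \ Z) ∪ frontier ends U Z ω')))
      = (weight p ω * weight p ω') *
          (prob p (L1 ends (U \ Z) s a o ((X \ Z) ∪ frontier ends U Z ω)) *
          prob p (L2 ends (U \ Z) s a o ((Y \ Z) ∪ frontier ends U Z ω'))) := by ring
    _ ≤ (weight p ω * weight p ω') *
          (prob p (R1 ends (U \ Z) s a o (frontier ends U Z (ω ⊓ ω'))) *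
          prob p (R2 ends (U \ Z) s a o (((X ∪ Y) \ Z) ∪ frontier ends U Z (ω ⊔ ω')))) :=
        mul_le_mul_of_nonneg_left
          (hIH.trans (mul_le_mul h3 (le_of_eq h4) (prob_nonneg hp _) (prob_nonneg hp _)))
          (mul_nonneg (weight_nonneg hp ω) (weight_nonneg hp ω'))
    _ = weight p (ω ⊓ ω') * prob p (R1 ends (U \ Z) s a o (frontier ends U Z (ω ⊓ ω'))) *
        (weight p (ω ⊔ ω') * prob p (R2 ends (U \ Z) s a o
          (((X ∪ Y) \ Z) ∪ frontier ends U Z (ω ⊔ ω')))) := by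
        rw [← weight_inf_mul_weight_sup p ω ω']
        ring

end Main

/-! ## The theorem on the whole graph -/

section Whole

variable {V : Type*} {E : Type*} [Fintype E] [DecidableEq E] [Fintype V] [DecidableEq V]
  {R : Type*} [CommRing R] [LinearOrder R] [IsStrictOrderedRing R]

omit [Fintype E] [DecidableEq E] [DecidableEq V] in
/-- On `U = univ` the induced connections are the connections. -/
lemma conn_induced_univ (ends : E → Sym2 V) (ω : Config E) (u v : V) :
    Conn ends (induced ends (↑(Finset.univ : Finset V)) ω) u v ↔ Conn ends ω u v := by
  rw [Finset.coe_univ, induced_univ]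

/-- **The two-mark avoidance inequality**: for a source `s`, marks `a, o` and vertex sets `X, Y`
of a finite graph,
`P(s↔a, s↮o, s↮X, o↮X) · P(s↔o, s↮a, s↮Y, a↮Y) ≤ P(s↔a, s↔o, s↮X∩Y) · P(s, a, o, X∪Y pairwise ↮)`,
stated with the induced events at `U = univ`. -/
theorem twoMark (p : E → R) (hp : IsProbVec p) (ends : E → Sym2 V) (s a o : V) (X Y : Finset V) :
    prob p (L1 ends Finset.univ s a o X) * prob p (L2 ends Finset.univ s a o Y) ≤
      prob p (R1 ends Finset.univ s a o (X ∩ Y)) * prob p (R2 ends Finset.univ s a o (X ∪ Y)) :=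
  twoMark_induced p hp ends s a o Finset.univ X Y (Finset.subset_univ X) (Finset.subset_univ Y)

end Whole

end TwoMark

/-! ## The cells of `CaseOneStarCells` as two-mark events with the source `b`, and `hB1` -/


namespace CaseOne

section Cells

variable {V : Type*} {E : Type*}

/-- Cell `1` assembled: `a₁ ↮ a₂`, `b ∈ C(a₁)`, `o ∉ C(a₁) ∪ C(a₂)`. -/
lemma cellIdx_eq_one {ends : E → Sym2 V} {ω : Config E} {o a₁ a₂ b : V}
    (hQ : ¬ Conn ends ω a₁ a₂) (hb : Conn ends ω a₁ b) (ho1 : ¬ Conn ends ω a₁ o)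
    (ho2 : ¬ Conn ends ω a₂ o) : cellIdx ends ω o a₁ a₂ b = 1 := by
  have hso : status ends ω a₁ a₂ o = 0 := by unfold status; rw [if_neg ho1, if_neg ho2]
  have hsb : status ends ω a₁ a₂ b = 1 := by unfold status; rw [if_pos hb]
  unfold cellIdx
  rw [if_neg hQ, if_neg (fun h => by rw [hsb] at h; exact one_ne_zero h.2), hso, hsb]

/-- Cell `4` assembled: `a₁ ↮ a₂`, `o, b ∈ C(a₁)`. -/
lemma cellIdx_eq_four {ends : E → Sym2 V} {ω : Config E} {o a₁ a₂ b : V}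
    (hQ : ¬ Conn ends ω a₁ a₂) (ho : Conn ends ω a₁ o) (hb : Conn ends ω a₁ b) :
    cellIdx ends ω o a₁ a₂ b = 4 := by
  have hso : status ends ω a₁ a₂ o = 1 := by unfold status; rw [if_pos ho]
  have hsb : status ends ω a₁ a₂ b = 1 := by unfold status; rw [if_pos hb]
  unfold cellIdx
  rw [if_neg hQ, if_neg (fun h => by rw [hsb] at h; exact one_ne_zero h.2), hso, hsb]

/-- Cell `10` assembled: `a₁ ↮ a₂`, `o, b ∉ C(a₁) ∪ C(a₂)`, `o ↔ b`. -/
lemma cellIdx_eq_ten {ends : E → Sym2 V} {ω : Config E} {o a₁ a₂ b : V}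
    (hQ : ¬ Conn ends ω a₁ a₂) (ho1 : ¬ Conn ends ω a₁ o) (ho2 : ¬ Conn ends ω a₂ o)
    (hb1 : ¬ Conn ends ω a₁ b) (hb2 : ¬ Conn ends ω a₂ b) (hob : Conn ends ω o b) :
    cellIdx ends ω o a₁ a₂ b = 10 := by
  unfold cellIdx
  rw [if_neg hQ, if_pos ⟨status_eq_zero_iff.2 ⟨ho1, ho2⟩, status_eq_zero_iff.2 ⟨hb1, hb2⟩⟩,
    if_pos hob]

/-- Cell `4` unpacked: `a₁ ↮ a₂`, `o ∈ C(a₁)`, `b ∈ C(a₁)`. -/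
lemma of_cellIdx_eq_four {ends : E → Sym2 V} {ω : Config E} {o a₁ a₂ b : V}
    (h : cellIdx ends ω o a₁ a₂ b = 4) :
    ¬ Conn ends ω a₁ a₂ ∧ Conn ends ω a₁ o ∧ Conn ends ω a₁ b := by
  unfold cellIdx at h
  by_cases hQ : Conn ends ω a₁ a₂
  · rw [if_pos hQ] at h; norm_num at h
  rw [if_neg hQ] at h
  by_cases hz : status ends ω a₁ a₂ o = 0 ∧ status ends ω a₁ a₂ b = 0
  · rw [if_pos hz] at h
    by_cases hob : Conn ends ω o b
    · rw [if_pos hob] at h; norm_num at h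
    · rw [if_neg hob] at h; norm_num at h
  rw [if_neg hz] at h
  rcases status_cases ends ω a₁ a₂ o with ho | ho | ho <;>
    rcases status_cases ends ω a₁ a₂ b with hb | hb | hb <;> rw [ho, hb] at h <;> norm_num at h
  exact ⟨hQ, conn_a1_of_status_eq_one ho, conn_a1_of_status_eq_one hb⟩

/-- Cell `9` unpacked: `a₁ ↮ a₂`, `o, b ∉ C(a₁) ∪ C(a₂)`, `o ↮ b`. -/
lemma of_cellIdx_eq_nine {ends : E → Sym2 V} {ω : Config E} {o a₁ a₂ b : V}
    (h : cellIdx ends ω o a₁ a₂ b = 9) :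
    ¬ Conn ends ω a₁ a₂ ∧ (¬ Conn ends ω a₁ o ∧ ¬ Conn ends ω a₂ o) ∧
      (¬ Conn ends ω a₁ b ∧ ¬ Conn ends ω a₂ b) ∧ ¬ Conn ends ω o b := by
  unfold cellIdx at h
  by_cases hQ : Conn ends ω a₁ a₂
  · rw [if_pos hQ] at h; norm_num at h
  rw [if_neg hQ] at h
  by_cases hz : status ends ω a₁ a₂ o = 0 ∧ status ends ω a₁ a₂ b = 0
  · rw [if_pos hz] at h
    by_cases hob : Conn ends ω o b
    · rw [if_pos hob] at h; norm_num at h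
    · exact ⟨hQ, status_eq_zero_iff.1 hz.1, status_eq_zero_iff.1 hz.2, hob⟩
  rw [if_neg hz] at h
  rcases status_cases ends ω a₁ a₂ o with ho | ho | ho <;>
    rcases status_cases ends ω a₁ a₂ b with hb | hb | hb <;> rw [ho, hb] at h <;> norm_num at h

end Cells

/-! ## The cells as two-mark events with the source `b` -/

section Translate

variable {V : Type*} {E : Type*} [Fintype E] [DecidableEq E] [Fintype V] [DecidableEq V]

omit [Fintype E] [DecidableEq E] in
/-- Cell `1` is `L1 {a₂}` with the source `b`. -/
lemma cell_one_eq_L1 (ends : E → Sym2 V) (o a₁ a₂ b : V) :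
    {ω : Config E | cellIdx ends ω o a₁ a₂ b = 1} =
      TwoMark.L1 ends Finset.univ b a₁ o {a₂} := by
  ext ω
  simp only [Set.mem_setOf_eq, TwoMark.L1, Set.mem_inter_iff, mem_QEvent, mem_REvent,
    Finset.forall_mem_union, Finset.mem_singleton, forall_eq, TwoMark.conn_induced_univ]
  constructor
  · intro h
    obtain ⟨hQ, hb, ho1, ho2⟩ := of_cellIdx_eq_one h
    exact ⟨⟨conn_symm hb, fun h' => ho1 (conn_trans hb h'), fun h' => hQ (conn_trans hb h')⟩,
      fun h' => ho2 (conn_symm h')⟩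
  · rintro ⟨⟨hb, hbo, hba⟩, hoa⟩
    exact cellIdx_eq_one (fun h' => hba (conn_trans hb h')) (conn_symm hb)
      (fun h' => hbo (conn_trans hb h')) (fun h' => hoa (conn_symm h'))

omit [Fintype E] [DecidableEq E] in
/-- Cell `10` is `L2 {a₂}` with the source `b`. -/
lemma cell_ten_eq_L2 (ends : E → Sym2 V) (o a₁ a₂ b : V) :
    {ω : Config E | cellIdx ends ω o a₁ a₂ b = 10} =
      TwoMark.L2 ends Finset.univ b a₁ o {a₂} := by
  ext ω
  simp only [Set.mem_setOf_eq, TwoMark.L2, Set.mem_inter_iff, mem_QEvent, mem_REvent,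
    Finset.forall_mem_union, Finset.mem_singleton, forall_eq, TwoMark.conn_induced_univ]
  constructor
  · intro h
    obtain ⟨hQ, ⟨_, _⟩, ⟨hb1, hb2⟩, hob⟩ := of_cellIdx_eq_ten h
    exact ⟨⟨conn_symm hob, fun h' => hb1 (conn_symm h'), fun h' => hb2 (conn_symm h')⟩, hQ⟩
  · rintro ⟨⟨hbo, hba1, hba2⟩, hQ⟩
    exact cellIdx_eq_ten hQ (fun h' => hba1 (conn_trans hbo (conn_symm h')))
      (fun h' => hba2 (conn_trans hbo (conn_symm h'))) (fun h' => hba1 (conn_symm h'))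
      (fun h' => hba2 (conn_symm h')) (conn_symm hbo)

omit [Fintype E] [DecidableEq E] in
/-- Cell `4` is `R1 {a₂}` with the source `b`. -/
lemma cell_four_eq_R1 (ends : E → Sym2 V) (o a₁ a₂ b : V) :
    {ω : Config E | cellIdx ends ω o a₁ a₂ b = 4} =
      TwoMark.R1 ends Finset.univ b a₁ o {a₂} := by
  ext ω
  simp only [Set.mem_setOf_eq, TwoMark.R1, Set.mem_inter_iff, mem_QEvent, mem_REvent,
    Finset.forall_mem_insert, Finset.mem_singleton, forall_eq, TwoMark.conn_induced_univ]
  constructor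
  · intro h
    obtain ⟨hQ, ho, hb⟩ := of_cellIdx_eq_four h
    exact ⟨⟨conn_symm hb, conn_trans (conn_symm hb) ho⟩, fun h' => hQ (conn_trans hb h')⟩
  · rintro ⟨⟨hba, hbo⟩, hba2⟩
    exact cellIdx_eq_four (fun h' => hba2 (conn_trans hba h')) (conn_trans (conn_symm hba) hbo)
      (conn_symm hba)

omit [Fintype E] [DecidableEq E] in
/-- Cell `9` is `R2 {a₂}` with the source `b`. -/
lemma cell_nine_eq_R2 (ends : E → Sym2 V) (o a₁ a₂ b : V) :
    {ω : Config E | cellIdx ends ω o a₁ a₂ b = 9} =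
      TwoMark.R2 ends Finset.univ b a₁ o {a₂} := by
  ext ω
  simp only [Set.mem_setOf_eq, TwoMark.R2, Set.mem_inter_iff, mem_REvent,
    Finset.forall_mem_union, Finset.forall_mem_insert, Finset.mem_singleton, forall_eq,
    TwoMark.conn_induced_univ]
  constructor
  · intro h
    obtain ⟨hQ, ⟨ho1, ho2⟩, ⟨hb1, hb2⟩, hob⟩ := of_cellIdx_eq_nine h
    exact ⟨⟨⟨⟨fun h' => hb1 (conn_symm h'), fun h' => hob (conn_symm h')⟩,
      fun h' => hb2 (conn_symm h')⟩, ho1, hQ⟩, fun h' => ho2 (conn_symm h')⟩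
  · rintro ⟨⟨⟨⟨hba1, hbo⟩, hba2⟩, ha1o, hQ⟩, hoa2⟩
    exact cellIdx_eq_nine hQ ha1o (fun h' => hoa2 (conn_symm h')) (fun h' => hba1 (conn_symm h'))
      (fun h' => hba2 (conn_symm h')) (fun h' => hbo (conn_symm h'))

end Translate

/-! ## The theorem -/

section Theorem

variable {V : Type*} {E : Type*} [Fintype E] [DecidableEq E] [Fintype V] [DecidableEq V]
  {R : Type*} [CommRing R] [LinearOrder R] [IsStrictOrderedRing R]

/-- **`hB1` is a theorem**: `c₁ · c₁₀ ≤ c₉ · c₄` for every finite graph, every product law and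
every four vertices — the case `s = b`, `a = a₁`, `X = Y = {a₂}` of the two-mark avoidance
inequality `TwoMark.twoMark`. -/
theorem HB1_holds (p : E → R) (hp : IsProbVec p) (ends : E → Sym2 V) (o a₁ a₂ b : V) :
    HB1 p ends o a₁ a₂ b := by
  unfold HB1 cellMass
  rw [cell_one_eq_L1, cell_ten_eq_L2, cell_four_eq_R1, cell_nine_eq_R2]
  have h := TwoMark.twoMark p hp ends b a₁ o {a₂} {a₂}
  rw [Finset.inter_self, Finset.union_self] at h
  rw [mul_comm (prob p (TwoMark.R2 ends Finset.univ b a₁ o {a₂}))]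
  exact h

end Theorem

end CaseOne

end Summit.Ventures.PercRepro2
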